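import Literature.NumberTheory.Automorphic.OrbitalMeasureOfLocalQuotient
import Literature.MeasureTheory.RestrictedProduct.HaarMapComponentwise
import Literature.MeasureTheory.RestrictedProduct.OrbitalEulerProduct
import Literature.MeasureTheory.Group.InvariantQuotientOrbitalProd
import HarnessLib

/-!
# Transport of adelic torus measures along a torus isomorphism that is componentwise in the model tower
(Rogawski (1990) §4.3 pp. 43–44, §14.5 pp. 237–238: the measures `dt = dt_∞ ⊗ ⊗_v dt_v` on the tori `T = G_γ`, `T′ = G′_{γ′}` of
stably conjugate regular elements are compared along the `F`-isomorphism `T ≅ T′`, place by place; Gelbart (1975) p. 155;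
Cassels–Fröhlich (1967) Ch. XV (Tate) §3.3: restricted-product measures)

Topic `NumberTheory/Automorphic` (generic layer, as ★ `OrbitalMeasureOfLocalQuotient`); namespace `Literature.NumberTheory.Automorphic`;
THEOREMS ONLY (no definition, no instance, no named fact).  Registry pub/hodgecm-mathlib F0∕P3a, ENGINE T1 (M-C) «measure coherence»,
row (O10-b3-δ4) of A-p06: the glue under (O-W) «β constant on regular stable classes».

Setting («model tower», twice: sides `1` and `2`).  Finite level: locally compact second countable groups `G_i` with compact open
`K_i`, a model isomorphism `e : G_f ≃ₜ* Πʳ(G_i ; K_i)`, an element `γ ∈ G_f`, Haar-type measures `t_i` on the local centralisers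
`C((eγ)_i) ≤ G_i`, and the finite torus measure `t_f` on `C(γ) ≤ G_f` given by the EXPRESSIONS of ★ `orbitalMeasureOfLocal_eq_quotientMeasure`
(`ρ = cutoutEquiv_* ∏'(t_i ; C ∩ K_i)`, `ρM = ρ` read on `C(eγ)`, `t_f = (e⁻¹|)_* ρM`).  Product level: `e_A : A_∞ × G_f ≃* A`
bicontinuous, `γ_A = e_A(γ_∞, γ)`, the torus measure `t_A = (e_A|)_* t_P` on `C(γ_A)` with `prodEquiv_* t_P = t_∞ ⊗ t_f`
(★ `orbitalMeasureOfProd_quotientMeasure_eq_quotientMeasure`).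

* §1 `exists_continuousMulEquiv_restrictedProduct_apply_eq` — local isomorphisms `P_i : H_i ≃ₜ* H′_i` respecting the bases off a finite
  set assemble to `Φ : Πʳ(H_i ; B_i) ≃ₜ* Πʳ(H′_i ; B′_i)` with `(Φ x)_i = P_i x_i` (∃-form of FLT's `ContinuousMulEquiv.restrictedProductCongrRight`).
* §2 `exists_homeomorph_map_finTorusMeasure_eq` — **finite level**: if `(P_i)_* t¹_i = t²_i` for local torus isomorphisms `P_i` with
  `P_i(c) ∈ K²_i ↔ c ∈ K¹_i` off a finite set, then there is a homeomorphism `P_f : C(γ¹) ≃ₜ C(γ²)`, componentwise `P_i` in the models,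
  with `(P_f)_* t¹_f = t²_f`.
* (sequel ★-to-be `TorusMeasureTowerTransportProd`: §3 product level `map_torusMeasure_eq_of_prod`, §4 both levels
  `map_torusMeasure_eq_of_componentwise`.)

With (δ1) ★ `map_eq_of_apply_compactCore_eq_one` (canonical local torus measures are carried to each other by ANY isomorphism) and
★ `covolume_count_eq_of_mulEquiv`, this is the measure-theoretic content of «stably conjugate regular `γ` have the same weight
`m(Z_γ(L⁺) \ Z_γ(𝔸))`» [Rogawski1990, §14.5 pp. 237–238]; the CM dress (the adelic stable-centraliser isomorphism ★
`adelicStableCentralizerEquiv` IS componentwise) is a separate file.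

## References
* J. D. Rogawski, *Automorphic Representations of Unitary Groups in Three Variables* (1990), §4.3 pp. 43–44, §14.5 pp. 237–238 [Rogawski1990].
* S. Gelbart, *Automorphic forms on adele groups* (1975), p. 155 (10.19) [Gelbart1975].
* J. W. S. Cassels, A. Fröhlich (eds.), *Algebraic Number Theory* (1967), Ch. XV (Tate) §3.3 [CasselsFrohlichANT1967].
-/

set_option autoImplicit false

noncomputable section

open _root_.MeasureTheory _root_.MeasureTheory.Measure Set Filter Function
open _root_.Topology
open Literature.Topology.RestrictedProduct Literature.Topology.Algebra.RestrictedProduct Literature.MeasureTheory.Group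
open Literature.MeasureTheory.RestrictedProduct
open scoped RestrictedProduct ENNReal NNReal Pointwise

namespace Literature.NumberTheory.Automorphic

universe u v w

/-! ## §1 Componentwise isomorphisms of restricted products (∃-form) -/

section CongrRight

variable {ι : Type u} {H₁ : ι → Type v} {H₂ : ι → Type w} [∀ i, Group (H₁ i)] [∀ i, Group (H₂ i)]
  [∀ i, TopologicalSpace (H₁ i)] [∀ i, TopologicalSpace (H₂ i)]
  (B₁ : ∀ i, Subgroup (H₁ i)) (B₂ : ∀ i, Subgroup (H₂ i))

/-- **Local isomorphisms respecting the bases off a finite set assemble to an isomorphism of restricted products**: for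
`P_i : H_i ≃ₜ* H′_i` with `P_i x ∈ B′_i ↔ x ∈ B_i` for all but finitely many `i`, there is `Φ : Πʳ(H_i ; B_i) ≃ₜ* Πʳ(H′_i ; B′_i)` with
`(Φ x)_i = P_i x_i` (Mathlib's `RestrictedProduct.map` both ways, continuous by `mapAlong_continuous`; the ∃-form of FLT's
`ContinuousMulEquiv.restrictedProductCongrRight`). [cite: CasselsFrohlichANT1967, Ch. XV (Tate) §3.3] -/
theorem exists_continuousMulEquiv_restrictedProduct_apply_eq (P : ∀ i, H₁ i ≃ₜ* H₂ i)
    (hP : ∀ᶠ i in cofinite, ∀ x, P i x ∈ B₂ i ↔ x ∈ B₁ i) :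
    ∃ Φ : (Πʳ i, [H₁ i, B₁ i]) ≃ₜ* (Πʳ i, [H₂ i, B₂ i]), ∀ x i, Φ x i = P i (x i) := by
  have h12 : ∀ᶠ i in cofinite, MapsTo (fun x => P i x) (B₁ i : Set (H₁ i)) (B₂ i : Set (H₂ i)) :=
    hP.mono fun i hi x hx => (hi x).2 hx
  have h21 : ∀ᶠ i in cofinite, MapsTo (fun y => (P i).symm y) (B₂ i : Set (H₂ i)) (B₁ i : Set (H₁ i)) :=
    hP.mono fun i hi y hy => by
      have h := (hi ((P i).symm y)).1
      rw [ContinuousMulEquiv.apply_symm_apply] at h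
      exact h hy
  refine ⟨{ toFun := RestrictedProduct.map (fun i x => P i x) h12
            invFun := RestrictedProduct.map (fun i y => (P i).symm y) h21
            left_inv := fun x => by
              ext i
              simp only [RestrictedProduct.map_apply, ContinuousMulEquiv.symm_apply_apply]
            right_inv := fun y => by
              ext i
              simp only [RestrictedProduct.map_apply, ContinuousMulEquiv.apply_symm_apply]
            map_mul' := fun x y => by
              ext i
              simp only [RestrictedProduct.map_apply, RestrictedProduct.mul_apply, map_mul]
            continuous_toFun := RestrictedProduct.mapAlong_continuous H₁ H₂ (A₁ := fun i => (B₁ i : Set (H₁ i)))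
              (A₂ := fun i => (B₂ i : Set (H₂ i))) (𝓕₁ := cofinite) (𝓕₂ := cofinite) id tendsto_id (fun i x => P i x) h12
              fun i => (P i).continuous
            continuous_invFun := RestrictedProduct.mapAlong_continuous H₂ H₁ (A₁ := fun i => (B₂ i : Set (H₂ i)))
              (A₂ := fun i => (B₁ i : Set (H₁ i))) (𝓕₁ := cofinite) (𝓕₂ := cofinite) id tendsto_id (fun i y => (P i).symm y) h21
              fun i => (P i).symm.continuous }, fun x i => rfl⟩

end CongrRight

/-! ## §2 Finite level: the torus measure of the restricted product along componentwise local isomorphisms -/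

section Fin

variable {ι : Type u} [Countable ι]
  -- side 1
  {G₁ : ι → Type v} [∀ i, Group (G₁ i)] [∀ i, TopologicalSpace (G₁ i)] [∀ i, IsTopologicalGroup (G₁ i)]
  [∀ i, SecondCountableTopology (G₁ i)] [∀ i, T2Space (G₁ i)]
  [∀ i, MeasurableSpace (G₁ i)] [∀ i, BorelSpace (G₁ i)]
  (K₁ : ∀ i, Subgroup (G₁ i)) [hK₁o : Fact (∀ i, IsOpen (K₁ i : Set (G₁ i)))] [hK₁c : ∀ i, CompactSpace (K₁ i)]
  [BorelSpace (Πʳ i, [G₁ i, K₁ i])]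
  {Gf₁ : Type*} [Group Gf₁] [TopologicalSpace Gf₁] [MeasurableSpace Gf₁] [BorelSpace Gf₁]
  (e₁ : Gf₁ ≃ₜ* (Πʳ i, [G₁ i, K₁ i])) (γ₁ : Gf₁)
  [hC₁ : ∀ i, IsClosed ((Subgroup.centralizer ({e₁ γ₁ i} : Set (G₁ i)) : Subgroup (G₁ i)) : Set (G₁ i))]
  (t₁ : ∀ i, Measure (Subgroup.centralizer ({e₁ γ₁ i} : Set (G₁ i)))) [∀ i, (t₁ i).IsMulLeftInvariant]
  [∀ i, IsFiniteMeasureOnCompacts (t₁ i)] [∀ i, (t₁ i).IsOpenPosMeasure] [∀ i, SigmaFinite (t₁ i)]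
  (S₁ : Finset ι)
  (ρ₁ : Measure (cutout K₁ (fun i => Subgroup.centralizer ({e₁ γ₁ i} : Set (G₁ i))) : Subgroup (Πʳ i, [G₁ i, K₁ i])))
  (ρM₁ : Measure (Subgroup.centralizer ({e₁ γ₁} : Set (Πʳ i, [G₁ i, K₁ i]))))
  (tf₁ : Measure (Subgroup.centralizer ({γ₁} : Set Gf₁)))
  -- side 2
  {G₂ : ι → Type w} [∀ i, Group (G₂ i)] [∀ i, TopologicalSpace (G₂ i)] [∀ i, IsTopologicalGroup (G₂ i)]
  [∀ i, SecondCountableTopology (G₂ i)] [∀ i, T2Space (G₂ i)]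
  [∀ i, MeasurableSpace (G₂ i)] [∀ i, BorelSpace (G₂ i)]
  (K₂ : ∀ i, Subgroup (G₂ i)) [hK₂o : Fact (∀ i, IsOpen (K₂ i : Set (G₂ i)))] [hK₂c : ∀ i, CompactSpace (K₂ i)]
  [BorelSpace (Πʳ i, [G₂ i, K₂ i])]
  {Gf₂ : Type*} [Group Gf₂] [TopologicalSpace Gf₂] [MeasurableSpace Gf₂] [BorelSpace Gf₂]
  (e₂ : Gf₂ ≃ₜ* (Πʳ i, [G₂ i, K₂ i])) (γ₂ : Gf₂)
  [hC₂ : ∀ i, IsClosed ((Subgroup.centralizer ({e₂ γ₂ i} : Set (G₂ i)) : Subgroup (G₂ i)) : Set (G₂ i))]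
  (t₂ : ∀ i, Measure (Subgroup.centralizer ({e₂ γ₂ i} : Set (G₂ i)))) [∀ i, (t₂ i).IsMulLeftInvariant]
  [∀ i, IsFiniteMeasureOnCompacts (t₂ i)] [∀ i, (t₂ i).IsOpenPosMeasure] [∀ i, SigmaFinite (t₂ i)]
  (S₂ : Finset ι)
  (ρ₂ : Measure (cutout K₂ (fun i => Subgroup.centralizer ({e₂ γ₂ i} : Set (G₂ i))) : Subgroup (Πʳ i, [G₂ i, K₂ i])))
  (ρM₂ : Measure (Subgroup.centralizer ({e₂ γ₂} : Set (Πʳ i, [G₂ i, K₂ i]))))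
  (tf₂ : Measure (Subgroup.centralizer ({γ₂} : Set Gf₂)))

/-- **Finite level.**  On each side the finite torus measure is the expression of ★ `orbitalMeasureOfLocal_eq_quotientMeasure`
(`hρ`, `hρM`, `htf`; `t_i(C ∩ K_i) = 1` off `S`).  If local isomorphisms `P_i : C((e¹γ¹)_i) ≃ₜ* C((e²γ²)_i)` carry `t¹_i` to `t²_i` and
satisfy `P_i c ∈ K²_i ↔ c ∈ K¹_i` for all but finitely many `i`, then some homeomorphism `P_f : C(γ¹) ≃ₜ C(γ²)` — componentwise `P_i` in
the models: `(e² (P_f x))_i = P_i ((e¹ x)_i)` — carries `t¹_f` to `t²_f`:  `⊗_v t′_v = (⊗_v e_v)_* ⊗_v t_v`.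
[cite: Rogawski1990, §4.3 pp. 43–44] [cite: CasselsFrohlichANT1967, Ch. XV (Tate) §3.3] -/
theorem exists_homeomorph_map_finTorusMeasure_eq
    (ht1₁ : ∀ i, i ∉ S₁ → t₁ i ((inH K₁ (fun i => Subgroup.centralizer ({e₁ γ₁ i} : Set (G₁ i))) i :
      Subgroup (Subgroup.centralizer ({e₁ γ₁ i} : Set (G₁ i)))) : Set (Subgroup.centralizer ({e₁ γ₁ i} : Set (G₁ i)))) = 1)
    (hρ₁ : ρ₁ = Measure.map (cutoutEquiv K₁ (fun i => Subgroup.centralizer ({e₁ γ₁ i} : Set (G₁ i))))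
      (rpMeasure (fun i => ((inH K₁ (fun i => Subgroup.centralizer ({e₁ γ₁ i} : Set (G₁ i))) i :
        Subgroup (Subgroup.centralizer ({e₁ γ₁ i} : Set (G₁ i)))) : Set (Subgroup.centralizer ({e₁ γ₁ i} : Set (G₁ i))))) t₁ S₁))
    (hρM₁ : ρM₁ = Measure.map (subgroupCongrHomeomorph (MulEquiv.refl (Πʳ i, [G₁ i, K₁ i]))
      (cutout K₁ (fun i => Subgroup.centralizer ({e₁ γ₁ i} : Set (G₁ i)))) (Subgroup.centralizer ({e₁ γ₁} : Set (Πʳ i, [G₁ i, K₁ i])))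
      (forall_refl_mem_iff K₁ (fun i => Subgroup.centralizer ({e₁ γ₁ i} : Set (G₁ i))) _
        (mem_centralizer_singleton_iff_forall_mem K₁ (e₁ γ₁)))
      continuous_id continuous_id) ρ₁)
    (htf₁ : tf₁ = Measure.map (subgroupCongrHomeomorph e₁.symm.toMulEquiv (Subgroup.centralizer ({e₁ γ₁} : Set (Πʳ i, [G₁ i, K₁ i])))
      (Subgroup.centralizer ({γ₁} : Set Gf₁)) (forall_apply_mem_centralizer_singleton_iff_of_eq e₁.symm.toMulEquiv (e₁.symm_apply_apply γ₁))
      e₁.symm.continuous e₁.continuous) ρM₁)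
    (ht1₂ : ∀ i, i ∉ S₂ → t₂ i ((inH K₂ (fun i => Subgroup.centralizer ({e₂ γ₂ i} : Set (G₂ i))) i :
      Subgroup (Subgroup.centralizer ({e₂ γ₂ i} : Set (G₂ i)))) : Set (Subgroup.centralizer ({e₂ γ₂ i} : Set (G₂ i)))) = 1)
    (hρ₂ : ρ₂ = Measure.map (cutoutEquiv K₂ (fun i => Subgroup.centralizer ({e₂ γ₂ i} : Set (G₂ i))))
      (rpMeasure (fun i => ((inH K₂ (fun i => Subgroup.centralizer ({e₂ γ₂ i} : Set (G₂ i))) i :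
        Subgroup (Subgroup.centralizer ({e₂ γ₂ i} : Set (G₂ i)))) : Set (Subgroup.centralizer ({e₂ γ₂ i} : Set (G₂ i))))) t₂ S₂))
    (hρM₂ : ρM₂ = Measure.map (subgroupCongrHomeomorph (MulEquiv.refl (Πʳ i, [G₂ i, K₂ i]))
      (cutout K₂ (fun i => Subgroup.centralizer ({e₂ γ₂ i} : Set (G₂ i)))) (Subgroup.centralizer ({e₂ γ₂} : Set (Πʳ i, [G₂ i, K₂ i])))
      (forall_refl_mem_iff K₂ (fun i => Subgroup.centralizer ({e₂ γ₂ i} : Set (G₂ i))) _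
        (mem_centralizer_singleton_iff_forall_mem K₂ (e₂ γ₂)))
      continuous_id continuous_id) ρ₂)
    (htf₂ : tf₂ = Measure.map (subgroupCongrHomeomorph e₂.symm.toMulEquiv (Subgroup.centralizer ({e₂ γ₂} : Set (Πʳ i, [G₂ i, K₂ i])))
      (Subgroup.centralizer ({γ₂} : Set Gf₂)) (forall_apply_mem_centralizer_singleton_iff_of_eq e₂.symm.toMulEquiv (e₂.symm_apply_apply γ₂))
      e₂.symm.continuous e₂.continuous) ρM₂)
    (P : ∀ i, Subgroup.centralizer ({e₁ γ₁ i} : Set (G₁ i)) ≃ₜ* Subgroup.centralizer ({e₂ γ₂ i} : Set (G₂ i)))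
    (hPK : ∀ᶠ i in cofinite, ∀ c : Subgroup.centralizer ({e₁ γ₁ i} : Set (G₁ i)),
      ((P i c : Subgroup.centralizer ({e₂ γ₂ i} : Set (G₂ i))) : G₂ i) ∈ K₂ i ↔ (c : G₁ i) ∈ K₁ i)
    (ht : ∀ i, Measure.map (P i) (t₁ i) = t₂ i) :
    ∃ Pf : Subgroup.centralizer ({γ₁} : Set Gf₁) ≃ₜ Subgroup.centralizer ({γ₂} : Set Gf₂),
      (∀ (x : Subgroup.centralizer ({γ₁} : Set Gf₁)) (i : ι) (hx : e₁ (x : Gf₁) i ∈ Subgroup.centralizer ({e₁ γ₁ i} : Set (G₁ i))),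
        e₂ ((Pf x : Subgroup.centralizer ({γ₂} : Set Gf₂)) : Gf₂) i =
          ((P i ⟨e₁ (x : Gf₁) i, hx⟩ : Subgroup.centralizer ({e₂ γ₂ i} : Set (G₂ i))) : G₂ i)) ∧
      Measure.map Pf tf₁ = tf₂ := by
  classical
  -- instances on the local tori and their restricted products
  haveI : ∀ i, (t₁ i).IsHaarMeasure := fun i => {}
  haveI : ∀ i, (t₂ i).IsHaarMeasure := fun i => {}
  haveI hB₁c : ∀ i, CompactSpace (inH K₁ (fun i => Subgroup.centralizer ({e₁ γ₁ i} : Set (G₁ i))) i) := fun i => isCompact_iff_compactSpace.1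
    ((hC₁ i).isClosedEmbedding_subtypeVal.isCompact_preimage (isCompact_iff_compactSpace.2 (hK₁c i)))
  haveI hB₂c : ∀ i, CompactSpace (inH K₂ (fun i => Subgroup.centralizer ({e₂ γ₂ i} : Set (G₂ i))) i) := fun i => isCompact_iff_compactSpace.1
    ((hC₂ i).isClosedEmbedding_subtypeVal.isCompact_preimage (isCompact_iff_compactSpace.2 (hK₂c i)))
  have hB₁m : ∀ i, MeasurableSet ((inH K₁ (fun i => Subgroup.centralizer ({e₁ γ₁ i} : Set (G₁ i))) i : Subgroup ((Subgroup.centralizer ({e₁ γ₁ i} : Set (G₁ i))))) : Set ((Subgroup.centralizer ({e₁ γ₁ i} : Set (G₁ i))))) := fun i => (isOpen_inH K₁ (fun i => Subgroup.centralizer ({e₁ γ₁ i} : Set (G₁ i))) hK₁o.out i).measurableSet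
  have hB₂m : ∀ i, MeasurableSet ((inH K₂ (fun i => Subgroup.centralizer ({e₂ γ₂ i} : Set (G₂ i))) i : Subgroup ((Subgroup.centralizer ({e₂ γ₂ i} : Set (G₂ i))))) : Set ((Subgroup.centralizer ({e₂ γ₂ i} : Set (G₂ i))))) := fun i => (isOpen_inH K₂ (fun i => Subgroup.centralizer ({e₂ γ₂ i} : Set (G₂ i))) hK₂o.out i).measurableSet
  haveI : BorelSpace (Πʳ i, [(Subgroup.centralizer ({e₁ γ₁ i} : Set (G₁ i))), inH K₁ (fun i => Subgroup.centralizer ({e₁ γ₁ i} : Set (G₁ i))) i]) := borelSpace (fun i => ((inH K₁ (fun i => Subgroup.centralizer ({e₁ γ₁ i} : Set (G₁ i))) i : Subgroup ((Subgroup.centralizer ({e₁ γ₁ i} : Set (G₁ i))))) : Set ((Subgroup.centralizer ({e₁ γ₁ i} : Set (G₁ i)))))) hB₁m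
  haveI : BorelSpace (Πʳ i, [(Subgroup.centralizer ({e₂ γ₂ i} : Set (G₂ i))), inH K₂ (fun i => Subgroup.centralizer ({e₂ γ₂ i} : Set (G₂ i))) i]) := borelSpace (fun i => ((inH K₂ (fun i => Subgroup.centralizer ({e₂ γ₂ i} : Set (G₂ i))) i : Subgroup ((Subgroup.centralizer ({e₂ γ₂ i} : Set (G₂ i))))) : Set ((Subgroup.centralizer ({e₂ γ₂ i} : Set (G₂ i)))))) hB₂m
  haveI : SecondCountableTopology (Πʳ i, [(Subgroup.centralizer ({e₂ γ₂ i} : Set (G₂ i))), inH K₂ (fun i => Subgroup.centralizer ({e₂ γ₂ i} : Set (G₂ i))) i]) :=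
    secondCountableTopology (fun i => ((inH K₂ (fun i => Subgroup.centralizer ({e₂ γ₂ i} : Set (G₂ i))) i : Subgroup ((Subgroup.centralizer ({e₂ γ₂ i} : Set (G₂ i))))) : Set ((Subgroup.centralizer ({e₂ γ₂ i} : Set (G₂ i)))))) (isOpen_inH K₂ (fun i => Subgroup.centralizer ({e₂ γ₂ i} : Set (G₂ i))) hK₂o.out)
  -- a common exceptional set
  obtain ⟨T, hT⟩ : ∃ T : Finset ι, ∀ i, i ∉ T → ∀ c : (Subgroup.centralizer ({e₁ γ₁ i} : Set (G₁ i))), ((P i c : (Subgroup.centralizer ({e₂ γ₂ i} : Set (G₂ i)))) : G₂ i) ∈ K₂ i ↔ (c : G₁ i) ∈ K₁ i := by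
    have hfin : Set.Finite {i | ¬ ∀ c : (Subgroup.centralizer ({e₁ γ₁ i} : Set (G₁ i))), ((P i c : (Subgroup.centralizer ({e₂ γ₂ i} : Set (G₂ i)))) : G₂ i) ∈ K₂ i ↔ (c : G₁ i) ∈ K₁ i} := hPK
    exact ⟨hfin.toFinset, fun i hi => by
      by_contra h
      exact hi (hfin.mem_toFinset.2 h)⟩
  set S : Finset ι := S₁ ∪ S₂ ∪ T with hSdef
  have hS₁ : S₁ ⊆ S := (Finset.subset_union_left).trans Finset.subset_union_left
  have hS₂ : S₂ ⊆ S := (Finset.subset_union_right).trans Finset.subset_union_left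
  have hTS : T ⊆ S := Finset.subset_union_right
  have ht1₁' : ∀ i, i ∉ S → t₁ i ((inH K₁ (fun i => Subgroup.centralizer ({e₁ γ₁ i} : Set (G₁ i))) i : Subgroup ((Subgroup.centralizer ({e₁ γ₁ i} : Set (G₁ i))))) : Set ((Subgroup.centralizer ({e₁ γ₁ i} : Set (G₁ i))))) = 1 := fun i hi => ht1₁ i fun h => hi (hS₁ h)
  have ht1₂' : ∀ i, i ∉ S → t₂ i ((inH K₂ (fun i => Subgroup.centralizer ({e₂ γ₂ i} : Set (G₂ i))) i : Subgroup ((Subgroup.centralizer ({e₂ γ₂ i} : Set (G₂ i))))) : Set ((Subgroup.centralizer ({e₂ γ₂ i} : Set (G₂ i))))) = 1 := fun i hi => ht1₂ i fun h => hi (hS₂ h)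
  have hrp₁ : rpMeasure (fun i => ((inH K₁ (fun i => Subgroup.centralizer ({e₁ γ₁ i} : Set (G₁ i))) i : Subgroup ((Subgroup.centralizer ({e₁ γ₁ i} : Set (G₁ i))))) : Set ((Subgroup.centralizer ({e₁ γ₁ i} : Set (G₁ i)))))) t₁ S₁ =
      rpMeasure (fun i => ((inH K₁ (fun i => Subgroup.centralizer ({e₁ γ₁ i} : Set (G₁ i))) i : Subgroup ((Subgroup.centralizer ({e₁ γ₁ i} : Set (G₁ i))))) : Set ((Subgroup.centralizer ({e₁ γ₁ i} : Set (G₁ i)))))) t₁ S :=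
    rpMeasure_eq_of_subset _ t₁ (fun i => ⟨1, (inH K₁ (fun i => Subgroup.centralizer ({e₁ γ₁ i} : Set (G₁ i))) i).one_mem⟩) hB₁m hS₁ ht1₁
  have hrp₂ : rpMeasure (fun i => ((inH K₂ (fun i => Subgroup.centralizer ({e₂ γ₂ i} : Set (G₂ i))) i : Subgroup ((Subgroup.centralizer ({e₂ γ₂ i} : Set (G₂ i))))) : Set ((Subgroup.centralizer ({e₂ γ₂ i} : Set (G₂ i)))))) t₂ S₂ =
      rpMeasure (fun i => ((inH K₂ (fun i => Subgroup.centralizer ({e₂ γ₂ i} : Set (G₂ i))) i : Subgroup ((Subgroup.centralizer ({e₂ γ₂ i} : Set (G₂ i))))) : Set ((Subgroup.centralizer ({e₂ γ₂ i} : Set (G₂ i)))))) t₂ S :=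
    rpMeasure_eq_of_subset _ t₂ (fun i => ⟨1, (inH K₂ (fun i => Subgroup.centralizer ({e₂ γ₂ i} : Set (G₂ i))) i).one_mem⟩) hB₂m hS₂ ht1₂
  -- the componentwise isomorphism of the torus restricted products
  obtain ⟨Φ, hΦ⟩ := exists_continuousMulEquiv_restrictedProduct_apply_eq (inH K₁ (fun i => Subgroup.centralizer ({e₁ γ₁ i} : Set (G₁ i)))) (inH K₂ (fun i => Subgroup.centralizer ({e₂ γ₂ i} : Set (G₂ i)))) P (by
    refine (hPK : ∀ᶠ i in cofinite, _).mono fun i hi c => ?_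
    rw [Subgroup.mem_subgroupOf, Subgroup.mem_subgroupOf]
    exact hi c)
  have hδ : Measure.map Φ (rpMeasure (fun i => ((inH K₁ (fun i => Subgroup.centralizer ({e₁ γ₁ i} : Set (G₁ i))) i : Subgroup ((Subgroup.centralizer ({e₁ γ₁ i} : Set (G₁ i))))) : Set ((Subgroup.centralizer ({e₁ γ₁ i} : Set (G₁ i)))))) t₁ S) =
      rpMeasure (fun i => ((inH K₂ (fun i => Subgroup.centralizer ({e₂ γ₂ i} : Set (G₂ i))) i : Subgroup ((Subgroup.centralizer ({e₂ γ₂ i} : Set (G₂ i))))) : Set ((Subgroup.centralizer ({e₂ γ₂ i} : Set (G₂ i)))))) t₂ S :=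
    map_rpMeasure_eq_rpMeasure_of_componentwise (inH K₁ (fun i => Subgroup.centralizer ({e₁ γ₁ i} : Set (G₁ i)))) (inH K₂ (fun i => Subgroup.centralizer ({e₂ γ₂ i} : Set (G₂ i)))) t₁ t₂ S ht1₁' ht1₂' Φ (fun i c => P i c)
      (fun i => (P i).continuous.measurable) hΦ (fun i hi => by
        ext c
        rw [mem_preimage, SetLike.mem_coe, SetLike.mem_coe, Subgroup.mem_subgroupOf, Subgroup.mem_subgroupOf]
        exact hT i (fun h => hi (hTS h)) c) ht
  -- the two towers
  set U₁ := ((cutoutEquiv K₁ (fun i => Subgroup.centralizer ({e₁ γ₁ i} : Set (G₁ i)))).toHomeomorph.trans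
      (subgroupCongrHomeomorph (MulEquiv.refl (Πʳ i, [G₁ i, K₁ i])) (cutout K₁ (fun i => Subgroup.centralizer ({e₁ γ₁ i} : Set (G₁ i)))) (Subgroup.centralizer ({e₁ γ₁} : Set (Πʳ i, [G₁ i, K₁ i])))
        (forall_refl_mem_iff K₁ (fun i => Subgroup.centralizer ({e₁ γ₁ i} : Set (G₁ i))) _ (mem_centralizer_singleton_iff_forall_mem K₁ (e₁ γ₁))) continuous_id continuous_id)).trans
      (subgroupCongrHomeomorph e₁.symm.toMulEquiv (Subgroup.centralizer ({e₁ γ₁} : Set (Πʳ i, [G₁ i, K₁ i])))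
        (Subgroup.centralizer ({γ₁} : Set Gf₁)) (forall_apply_mem_centralizer_singleton_iff_of_eq e₁.symm.toMulEquiv (e₁.symm_apply_apply γ₁))
        e₁.symm.continuous e₁.continuous) with hU₁
  set U₂ := ((cutoutEquiv K₂ (fun i => Subgroup.centralizer ({e₂ γ₂ i} : Set (G₂ i)))).toHomeomorph.trans
      (subgroupCongrHomeomorph (MulEquiv.refl (Πʳ i, [G₂ i, K₂ i])) (cutout K₂ (fun i => Subgroup.centralizer ({e₂ γ₂ i} : Set (G₂ i)))) (Subgroup.centralizer ({e₂ γ₂} : Set (Πʳ i, [G₂ i, K₂ i])))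
        (forall_refl_mem_iff K₂ (fun i => Subgroup.centralizer ({e₂ γ₂ i} : Set (G₂ i))) _ (mem_centralizer_singleton_iff_forall_mem K₂ (e₂ γ₂))) continuous_id continuous_id)).trans
      (subgroupCongrHomeomorph e₂.symm.toMulEquiv (Subgroup.centralizer ({e₂ γ₂} : Set (Πʳ i, [G₂ i, K₂ i])))
        (Subgroup.centralizer ({γ₂} : Set Gf₂)) (forall_apply_mem_centralizer_singleton_iff_of_eq e₂.symm.toMulEquiv (e₂.symm_apply_apply γ₂))
        e₂.symm.continuous e₂.continuous) with hU₂
  -- coordinates of the towers: `e (U y) = (y_i)_i`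
  have hU₁c : ∀ (y : Πʳ i, [(Subgroup.centralizer ({e₁ γ₁ i} : Set (G₁ i))), inH K₁ (fun i => Subgroup.centralizer ({e₁ γ₁ i} : Set (G₁ i))) i]) (i : ι), e₁ ((U₁ y : Subgroup.centralizer ({γ₁} : Set Gf₁)) : Gf₁) i = ((y i : (Subgroup.centralizer ({e₁ γ₁ i} : Set (G₁ i)))) : G₁ i) := by
    intro y i
    change e₁ (e₁.symm ((cutoutEquiv K₁ (fun i => Subgroup.centralizer ({e₁ γ₁ i} : Set (G₁ i))) y : cutout K₁ (fun i => Subgroup.centralizer ({e₁ γ₁ i} : Set (G₁ i)))) : Πʳ i, [G₁ i, K₁ i])) i = _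
    rw [ContinuousMulEquiv.apply_symm_apply, coe_cutoutEquiv_apply]
  have hU₂c : ∀ (y : Πʳ i, [(Subgroup.centralizer ({e₂ γ₂ i} : Set (G₂ i))), inH K₂ (fun i => Subgroup.centralizer ({e₂ γ₂ i} : Set (G₂ i))) i]) (i : ι), e₂ ((U₂ y : Subgroup.centralizer ({γ₂} : Set Gf₂)) : Gf₂) i = ((y i : (Subgroup.centralizer ({e₂ γ₂ i} : Set (G₂ i)))) : G₂ i) := by
    intro y i
    change e₂ (e₂.symm ((cutoutEquiv K₂ (fun i => Subgroup.centralizer ({e₂ γ₂ i} : Set (G₂ i))) y : cutout K₂ (fun i => Subgroup.centralizer ({e₂ γ₂ i} : Set (G₂ i)))) : Πʳ i, [G₂ i, K₂ i])) i = _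
    rw [ContinuousMulEquiv.apply_symm_apply, coe_cutoutEquiv_apply]
  -- the torus measures through the towers
  have htf₁' : tf₁ = Measure.map U₁ (rpMeasure (fun i => ((inH K₁ (fun i => Subgroup.centralizer ({e₁ γ₁ i} : Set (G₁ i))) i : Subgroup ((Subgroup.centralizer ({e₁ γ₁ i} : Set (G₁ i))))) : Set ((Subgroup.centralizer ({e₁ γ₁ i} : Set (G₁ i)))))) t₁ S) := by
    rw [htf₁, hρM₁, hρ₁, hrp₁, Measure.map_map (Homeomorph.measurable _) (Homeomorph.measurable _),
      Measure.map_map ((Homeomorph.measurable _).comp (Homeomorph.measurable _))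
        (map_continuous (cutoutEquiv K₁ (fun i => Subgroup.centralizer ({e₁ γ₁ i} : Set (G₁ i))))).measurable]
    rfl
  have htf₂' : tf₂ = Measure.map U₂ (rpMeasure (fun i => ((inH K₂ (fun i => Subgroup.centralizer ({e₂ γ₂ i} : Set (G₂ i))) i : Subgroup ((Subgroup.centralizer ({e₂ γ₂ i} : Set (G₂ i))))) : Set ((Subgroup.centralizer ({e₂ γ₂ i} : Set (G₂ i)))))) t₂ S) := by
    rw [htf₂, hρM₂, hρ₂, hrp₂, Measure.map_map (Homeomorph.measurable _) (Homeomorph.measurable _),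
      Measure.map_map ((Homeomorph.measurable _).comp (Homeomorph.measurable _))
        (map_continuous (cutoutEquiv K₂ (fun i => Subgroup.centralizer ({e₂ γ₂ i} : Set (G₂ i))))).measurable]
    rfl
  refine ⟨(U₁.symm.trans Φ.toHomeomorph).trans U₂, fun x i hx => ?_, ?_⟩
  · -- componentwise: `e² (U₂ (Φ (U₁⁻¹ x)))_i = (Φ (U₁⁻¹ x))_i = P_i ((U₁⁻¹ x)_i)` and `(U₁⁻¹ x)_i = (e¹ x)_i`
    change e₂ ((U₂ (Φ (U₁.symm x)) : Subgroup.centralizer ({γ₂} : Set Gf₂)) : Gf₂) i = _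
    rw [hU₂c, hΦ]
    congr 2
  · rw [htf₁', htf₂', Measure.map_map (Homeomorph.measurable _) (Homeomorph.measurable _)]
    change Measure.map ((U₂ ∘ Φ) ∘ (U₁.symm ∘ U₁)) _ = _
    rw [Homeomorph.symm_comp_self, Function.comp_id, ← Measure.map_map (Homeomorph.measurable _) (map_continuous Φ).measurable, hδ]

end Fin

end Literature.NumberTheory.Automorphic
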